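import Mathlib
import Literature.Analysis.ValidatedNumerics.BoxCover
import Literature.Analysis.ValidatedNumerics.AffineArithmetic
import Summits.NavierStokesRegularity.NavierStokesRegularity.Theorems.SubOnsagerCeilingVirtualFloorKernelFaceMul
import HarnessLib

/-!
# Kernel face checks by fixed-point AFFINE ARITHMETIC on kd-leaves (per-leaf multipliers)
(helper file for crux stmt-NavierStokesRegularity-27057 `SubOnsagerCeiling.ForwardTailCeilingKP`, `--supports … --as helper`;
LEAD SOC g11, line «kp-shell-barrier», Ω-coupled four-window face certificates, census v13 §K.5 NEXT (2))

`VirtualFloor.KernelFaceMul` (p694808) certifies `e ≤ b` on the part of a box where slacks `gᵢ ≥ 0` hold, leaf by leaf over a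
kd-tree (`Literature.Analysis.ValidatedNumerics.KdCert`), with per-leaf multipliers and the NATURAL INTERVAL EXTENSION
(`ArithExpr.enclose`) as the leaf enclosure. For the cubic inertial forms of the quadric floor faces of census v13 §K.5 the
natural interval extension loses all correlations between the occurrences of a variable (enclosure width `≈ 5` on a `0.2`-cell
against margins `0.3–0.7`), so the leaf count explodes. The standard cure is a first-order correlated enclosure; the tree's
validated-numerics layer already has one: `Literature.Analysis.ValidatedNumerics.AForm` (fixed-point affine arithmetic of
de Figueiredo–Stolfi with inclusion theorems `mem_ofRat/add/sub/neg/mul`, `le_hi`). This file plugs it into the kd-tree format: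

* `affVar S B j` — the affine form of the `j`-th coordinate of the leaf box `B` (noise symbol `ε_j`), `noise B x` — the noise
  values of a point of the box, `noise_valid`, `mem_affVar`;
* `affEval S B e` — affine evaluation of an `ArithExpr` (structural recursion, kernel-evaluable), inclusion `mem_affEval`;
* `mulSumNZ lams gs` — `Σ λᵢ gᵢ` skipping zero multipliers (a leaf pays only for its active slacks), `eval_mulSumNZ_nonneg`;
* `leafCheckAff e gs b` — leaf check «all `λᵢ ≥ 0` and `hi (affEval (e + Σ λᵢ gᵢ)) ≤ ⌊b·S⌋`» with `S = 2^prec`, leaf datum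
  `KernelFaceMul.LeafMul = (prec, lams)` (same certificate syntax as p694808); soundness `leafCheckAff_sound`,
  `eval_le_of_kdCheckAff`, `eval_lt_zero_of_kdCheckAff` (strict, inertial hypotheses), `eval_nonneg_of_kdCheckAff` (damping signs);
* `substVar s q e` — substitution of an expression for a variable (elimination of the coordinate fixed by the active face),
  `eval_substVar`, and the eliminated-coordinate forms `eval_lt_zero_of_kdCheckAff_subst` / `eval_nonneg_of_kdCheckAff_subst`.

HONEST FRAMING: plumbing (validated numerics ↔ face-certificate lemmas) towards a MODEL-lattice rung (crux `ForwardTailCeilingKP`,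
route SubOnsagerCeiling, TL-M2Break); it certifies no design by itself; nothing here bears on Navier–Stokes regularity; 27057 stays
OPEN. [cite: FigueiredoStolfi2004, §2–§3 (affine forms, affine operations)] [cite: Moore1966, §4.4 (refinement by subdivision)]
-/

-- the sub-problem namespace `NavierStokesRegularity.NavierStokesRegularity` is the tree's layout (D-0017)
set_option linter.dupNamespace false

namespace Summit.NavierStokesRegularity.NavierStokesRegularity.Theorems.VirtualFloor.KernelFaceAffine

open Literature.Analysis.ValidatedNumerics KernelFaceMul

/-- The affine form of the `j`-th coordinate of the box `B` at scale `S`: scaled centre `⌊m S⌋`, coefficient `⌈h S⌉` on the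
noise symbol `ε_j`, radius `2` (two roundings), where `m, h` are the midpoint and half-width of the `j`-th interval.
[cite: FigueiredoStolfi2004, §2] -/
def affVar (S : ℕ) (B : Box) (j : ℕ) : AForm :=
  ⟨⌊((B.ivl j).1 + (B.ivl j).2) / 2 * (S : ℚ)⌋,
    List.replicate j 0 ++ [⌈((B.ivl j).2 - (B.ivl j).1) / 2 * (S : ℚ)⌉], 2⟩

/-- **Affine evaluation** of an arithmetic expression on the box `B` at scale `S` (constants `AForm.ofRat`, variables `affVar`,
exact `add/sub/neg`, rounded `mul`); structural recursion, kernel-evaluable. [cite: FigueiredoStolfi2004, §3] -/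
def affEval (S : ℕ) (B : Box) : ArithExpr → AForm
  | .const q => AForm.ofRat S q
  | .var i => affVar S B i
  | .add e₁ e₂ => AForm.add (affEval S B e₁) (affEval S B e₂)
  | .sub e₁ e₂ => AForm.sub (affEval S B e₁) (affEval S B e₂)
  | .mul e₁ e₂ => AForm.mul S (affEval S B e₁) (affEval S B e₂)
  | .neg e => AForm.neg (affEval S B e)

/-- The noise values of a point `x` of the box `B`: `ε_j = (x_j − m_j)/h_j` on non-degenerate coordinates, `0` otherwise.
[cite: FigueiredoStolfi2004, §2] -/
noncomputable def noise (B : Box) (x : ℕ → ℝ) (j : ℕ) : ℝ :=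
  if (B.ivl j).1 < (B.ivl j).2 then
    (x j - ((((B.ivl j).1 + (B.ivl j).2) / 2 : ℚ) : ℝ)) / ((((B.ivl j).2 - (B.ivl j).1) / 2 : ℚ) : ℝ)
  else 0

/-- The noise values of a point of the box are admissible (`|ε_j| ≤ 1`). [cite: FigueiredoStolfi2004, §2] -/
theorem noise_valid {B : Box} {x : ℕ → ℝ} (hx : B.mem x) : AForm.Valid (noise B x) := by
  intro j
  obtain ⟨h1, h2⟩ := hx j
  unfold noise
  split_ifs with hlt
  · have hh : (0 : ℝ) < ((((B.ivl j).2 - (B.ivl j).1) / 2 : ℚ) : ℝ) := by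
      have : ((B.ivl j).1 : ℝ) < ((B.ivl j).2 : ℝ) := by exact_mod_cast hlt
      push_cast; linarith
    rw [abs_div, abs_of_pos hh, div_le_one hh, abs_le]
    push_cast
    constructor <;> linarith
  · simp

/-- The `j`-th coordinate of a point of the box lies in `affVar S B j`. [cite: FigueiredoStolfi2004, §2] -/
theorem mem_affVar (S : ℕ) {B : Box} {x : ℕ → ℝ} (hx : B.mem x) (j : ℕ) :
    AForm.mem S (noise B x) (x j) (affVar S B j) := by
  obtain ⟨h1, h2⟩ := hx j
  unfold AForm.mem affVar
  simp only [AForm.lin_replicate_append]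
  set m : ℚ := ((B.ivl j).1 + (B.ivl j).2) / 2 with hm
  set h : ℚ := ((B.ivl j).2 - (B.ivl j).1) / 2 with hh
  have hfl : |((⌊m * (S : ℚ)⌋ : ℤ) : ℝ) - (m : ℝ) * S| ≤ 1 :=
    AForm.abs_floor_sub_le (m * S) (by push_cast; ring)
  have hce : |((⌈h * (S : ℚ)⌉ : ℤ) : ℝ) - (h : ℝ) * S| ≤ 1 := by
    have e1 : ((⌈h * (S : ℚ)⌉ : ℤ) : ℝ) = (((⌈h * (S : ℚ)⌉ : ℤ) : ℚ) : ℝ) := by norm_cast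
    have c1 : (h * (S : ℚ) : ℚ) ≤ (⌈h * (S : ℚ)⌉ : ℤ) := Int.le_ceil _
    have c2 : ((⌈h * (S : ℚ)⌉ : ℤ) : ℚ) < h * (S : ℚ) + 1 := Int.ceil_lt_add_one _
    have c1' : ((h : ℝ) * S) ≤ (((⌈h * (S : ℚ)⌉ : ℤ) : ℚ) : ℝ) := by exact_mod_cast c1
    have c2' : (((⌈h * (S : ℚ)⌉ : ℤ) : ℚ) : ℝ) < (h : ℝ) * S + 1 := by exact_mod_cast c2
    rw [e1, abs_le]; constructor <;> linarith
  unfold noise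
  split_ifs with hlt
  · -- non-degenerate coordinate: `x S = m S + h S ε` exactly
    have hhp : (0 : ℝ) < (h : ℝ) := by
      have : ((B.ivl j).1 : ℝ) < ((B.ivl j).2 : ℝ) := by exact_mod_cast hlt
      rw [hh]; push_cast; linarith
    set ε : ℝ := (x j - (m : ℝ)) / (h : ℝ) with hε
    have hεb : |ε| ≤ 1 := by
      rw [hε, abs_div, abs_of_pos hhp, div_le_one hhp, abs_le]
      rw [hm, hh]; push_cast; constructor <;> linarith
    have hxS : x j * S = (m : ℝ) * S + (h : ℝ) * S * ε := by
      rw [hε]; field_simp; ring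
    have e2 : x j * S - ((⌊m * (S : ℚ)⌋ : ℤ) + (⌈h * (S : ℚ)⌉ : ℤ) * ε)
        = -((((⌊m * (S : ℚ)⌋ : ℤ) : ℝ) - (m : ℝ) * S)) + (-((((⌈h * (S : ℚ)⌉ : ℤ) : ℝ) - (h : ℝ) * S)) * ε) := by
      rw [hxS]; ring
    rw [e2]
    refine (abs_add_le _ _).trans ?_
    rw [abs_neg, abs_mul, abs_neg]
    have := mul_le_mul hce hεb (abs_nonneg _) (by norm_num : (0:ℝ) ≤ 1)
    push_cast
    linarith
  · -- degenerate coordinate: `x j = m`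
    have hle : ((B.ivl j).2 : ℝ) ≤ ((B.ivl j).1 : ℝ) := by exact_mod_cast (not_lt.1 hlt)
    have hxm : x j = (m : ℝ) := by rw [hm]; push_cast; linarith
    rw [mul_zero, add_zero, hxm, abs_sub_comm]
    push_cast
    linarith [hfl]

/-- **Inclusion property of the affine evaluation**: at a point of the box, the value of `e` lies in `affEval S B e` (with the
box's noise values). [cite: FigueiredoStolfi2004, §3] -/
theorem mem_affEval {S : ℕ} (hS : 0 < S) {B : Box} {x : ℕ → ℝ} (hx : B.mem x) :
    ∀ e : ArithExpr, AForm.mem S (noise B x) (e.eval x) (affEval S B e)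
  | .const q => by simpa [affEval] using AForm.mem_ofRat (ε := noise B x) S q
  | .var i => by simpa [affEval] using mem_affVar S hx i
  | .add e₁ e₂ => by
    simpa [affEval] using AForm.mem_add (mem_affEval hS hx e₁) (mem_affEval hS hx e₂)
  | .sub e₁ e₂ => by
    simpa [affEval] using AForm.mem_sub (mem_affEval hS hx e₁) (mem_affEval hS hx e₂)
  | .mul e₁ e₂ => by
    simpa [affEval] using AForm.mem_mul hS (noise_valid hx) (mem_affEval hS hx e₁) (mem_affEval hS hx e₂)
  | .neg e => by simpa [affEval] using AForm.mem_neg (mem_affEval hS hx e)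

/-- Range bound from the affine evaluation: `e ≤ hi/S` on the box. [cite: FigueiredoStolfi2004, §2] -/
theorem eval_mul_le_hi {S : ℕ} (hS : 0 < S) {B : Box} {x : ℕ → ℝ} (hx : B.mem x) (e : ArithExpr) :
    e.eval x * S ≤ ((affEval S B e).hi : ℝ) :=
  AForm.le_hi (noise_valid hx) (mem_affEval hS hx e)

/-- The expression `Σᵢ λᵢ · gᵢ` over the zipped lists, SKIPPING the terms with `λᵢ = 0` (so that a leaf pays only for its
active slacks in the kernel; the shorter list truncates the sum). [folklore] -/
def mulSumNZ : List ℚ → List ArithExpr → ArithExpr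
  | [], _ => .const 0
  | lam :: ls, gs =>
    match gs with
    | [] => .const 0
    | g :: gs' => if lam = 0 then mulSumNZ ls gs' else .add (.mul (.const lam) g) (mulSumNZ ls gs')

/-- The skipping multiplier sum is non-negative where every multiplier and every slack is non-negative. [folklore] -/
theorem eval_mulSumNZ_nonneg (x : ℕ → ℝ) :
    ∀ (ls : List ℚ) (gs : List ArithExpr), (∀ l ∈ ls, 0 ≤ l) → (∀ g ∈ gs, 0 ≤ g.eval x) →
      0 ≤ (mulSumNZ ls gs).eval x
  | [], gs, _, _ => by simp [mulSumNZ]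
  | _ :: _, [], _, _ => by simp [mulSumNZ]
  | lam :: ls, g :: gs, hl, hg => by
    have h1 : (0 : ℝ) ≤ lam := by exact_mod_cast hl lam (by simp)
    have h2 : 0 ≤ g.eval x := hg g (by simp)
    have h3 := eval_mulSumNZ_nonneg x ls gs (fun l hl' => hl l (by simp [hl'])) (fun g' hg' => hg g' (by simp [hg']))
    simp only [mulSumNZ]
    split_ifs
    · exact h3
    · simp only [ArithExpr.eval_add, ArithExpr.eval_mul, ArithExpr.eval_const]
      exact add_nonneg (mul_nonneg h1 h2) h3

/-- **The affine leaf check** (leaf datum `(prec, lams)` of `KernelFaceMul.LeafMul`, scale `S = 2^prec`): all multipliers are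
`≥ 0` and the upper end of the affine evaluation of `e + Σ λᵢ gᵢ` (zero multipliers skipped) on the leaf box is `≤ ⌊b S⌋`.
Kernel-evaluable. [cite: FigueiredoStolfi2004, §3] -/
def leafCheckAff (e : ArithExpr) (gs : List ArithExpr) (b : ℚ) (B : Box) (d : LeafMul) : Bool :=
  allNonneg d.lams &&
    decide ((affEval (2 ^ d.prec) B (.add e (mulSumNZ d.lams gs))).hi ≤ ⌊b * ((2 ^ d.prec : ℕ) : ℚ)⌋)

/-- Soundness of one affine leaf: where the slacks are non-negative, `e ≤ b`. [cite: FigueiredoStolfi2004, §3] -/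
theorem leafCheckAff_sound {e : ArithExpr} {gs : List ArithExpr} {b : ℚ} {B : Box} {d : LeafMul}
    (h : leafCheckAff e gs b B d = true) (x : ℕ → ℝ) (hx : B.mem x) (hg : ∀ g ∈ gs, 0 ≤ g.eval x) :
    e.eval x ≤ b := by
  rw [leafCheckAff, Bool.and_eq_true, decide_eq_true_iff] at h
  have hl : ∀ l ∈ d.lams, (0 : ℚ) ≤ l := (allNonneg_iff d.lams).1 h.1
  set S : ℕ := 2 ^ d.prec with hSdef
  have hS : 0 < S := by rw [hSdef]; positivity
  have hSr : (0 : ℝ) < (S : ℝ) := by exact_mod_cast hS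
  have hle := eval_mul_le_hi hS hx (.add e (mulSumNZ d.lams gs))
  have hnn := eval_mulSumNZ_nonneg x d.lams gs hl hg
  have h2 : (((affEval S B (.add e (mulSumNZ d.lams gs))).hi : ℤ) : ℝ) ≤ ((⌊b * (S : ℚ)⌋ : ℤ) : ℝ) := by
    exact_mod_cast h.2
  have h3 : ((⌊b * (S : ℚ)⌋ : ℤ) : ℝ) ≤ (b : ℝ) * S := by
    have := Int.floor_le (b * (S : ℚ))
    have h' : (((⌊b * (S : ℚ)⌋ : ℤ) : ℚ) : ℝ) ≤ ((b * (S : ℚ) : ℚ) : ℝ) := by exact_mod_cast this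
    push_cast at h'
    exact_mod_cast h'
  simp only [ArithExpr.eval_add] at hle
  have h4 : (e.eval x + (mulSumNZ d.lams gs).eval x) * S ≤ (b : ℝ) * S := hle.trans (h2.trans h3)
  have h5 : e.eval x + (mulSumNZ d.lams gs).eval x ≤ b := le_of_mul_le_mul_right h4 hSr
  linarith

/-- **`e ≤ b` on a box from an affine multiplier kd-tree**, wherever all slacks are non-negative (affine inclusion on every
leaf, S-procedure per leaf). [cite: FigueiredoStolfi2004, §3] [cite: Moore1966, §4.4] -/
theorem eval_le_of_kdCheckAff {e : ArithExpr} {gs : List ArithExpr} {b : ℚ} {B : Box} {t : KdCert LeafMul}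
    (h : t.check (leafCheckAff e gs b) B = true) (x : ℕ → ℝ) (hx : B.mem x) (hg : ∀ g ∈ gs, 0 ≤ g.eval x) :
    e.eval x ≤ b :=
  KdCert.sound (P := fun y => (∀ g ∈ gs, 0 ≤ g.eval y) → e.eval y ≤ (b : ℝ))
    (fun _ _ hl y hy hgy => leafCheckAff_sound hl y hy hgy) t B h x hx hg

/-- **Strict face condition from an affine multiplier kd-tree** (`b = −δ`, `δ > 0`): `e < 0` wherever the slacks are
non-negative — the shape of the INERTIAL hypotheses of `window4_le_of_coupledFaceCertB'` / `chain_le_of_coupledFaceCertB`.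
[cite: FigueiredoStolfi2004, §3] -/
theorem eval_lt_zero_of_kdCheckAff {e : ArithExpr} {gs : List ArithExpr} {δ : ℚ} {B : Box} {t : KdCert LeafMul}
    (hδ : 0 < δ) (h : t.check (leafCheckAff e gs (-δ)) B = true) (x : ℕ → ℝ) (hx : B.mem x)
    (hg : ∀ g ∈ gs, 0 ≤ g.eval x) : e.eval x < 0 := by
  have h1 := eval_le_of_kdCheckAff h x hx hg
  have hδ' : (0 : ℝ) < δ := by exact_mod_cast hδ
  have : ((-δ : ℚ) : ℝ) = -(δ : ℝ) := by push_cast; ring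
  rw [this] at h1
  linarith

/-- **Non-strict form (`0 ≤ e`)** for DAMPING-SIGN hypotheses: check `−e + Σ λᵢ gᵢ ≤ 0` leaf by leaf.
[cite: FigueiredoStolfi2004, §3] -/
theorem eval_nonneg_of_kdCheckAff {e : ArithExpr} {gs : List ArithExpr} {B : Box} {t : KdCert LeafMul}
    (h : t.check (leafCheckAff (.neg e) gs 0) B = true) (x : ℕ → ℝ) (hx : B.mem x)
    (hg : ∀ g ∈ gs, 0 ≤ g.eval x) : 0 ≤ e.eval x := by
  have h1 := eval_le_of_kdCheckAff h x hx hg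
  simp only [ArithExpr.eval_neg, Rat.cast_zero] at h1
  linarith

/-- Substitution of the expression `q` for the variable `s` (used to ELIMINATE the coordinate fixed by an active face: the
certificate is checked on `substVar s q e`, whose value at a point of the face equals that of `e`). [folklore] -/
def substVar (s : ℕ) (q : ArithExpr) : ArithExpr → ArithExpr
  | .const c => .const c
  | .var i => if i = s then q else .var i
  | .add e₁ e₂ => .add (substVar s q e₁) (substVar s q e₂)
  | .sub e₁ e₂ => .sub (substVar s q e₁) (substVar s q e₂)
  | .mul e₁ e₂ => .mul (substVar s q e₁) (substVar s q e₂)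
  | .neg e => .neg (substVar s q e)

/-- Semantics of the substitution: evaluate `e` at the point updated in slot `s` by the value of `q`. [folklore] -/
theorem eval_substVar (x : ℕ → ℝ) (s : ℕ) (q : ArithExpr) :
    ∀ e : ArithExpr, (substVar s q e).eval x = e.eval (Function.update x s (q.eval x))
  | .const c => by simp [substVar]
  | .var i => by
    by_cases h : i = s
    · subst h; simp [substVar]
    · simp [substVar, h]
  | .add e₁ e₂ => by simp [substVar, eval_substVar x s q e₁, eval_substVar x s q e₂]
  | .sub e₁ e₂ => by simp [substVar, eval_substVar x s q e₁, eval_substVar x s q e₂]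
  | .mul e₁ e₂ => by simp [substVar, eval_substVar x s q e₁, eval_substVar x s q e₂]
  | .neg e => by simp [substVar, eval_substVar x s q e]

/-- On the face `x s = q(x)` the substituted expression has the value of the original one. [folklore] -/
theorem eval_substVar_of_eq {x : ℕ → ℝ} {s : ℕ} {q : ArithExpr} (h : x s = q.eval x) (e : ArithExpr) :
    (substVar s q e).eval x = e.eval x := by
  rw [eval_substVar, ← h, Function.update_eq_self]

/-- **Face certificate with an eliminated coordinate**: if the kd-tree certifies `substVar s q e < 0` under the substituted slacks
`gs.map (substVar s q)` followed by the extra slacks `extra`, then at every point of the box lying ON the face `x s = q(x)` where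
the original slacks and the extras are non-negative, `e < 0`. [cite: FigueiredoStolfi2004, §3] -/
theorem eval_lt_zero_of_kdCheckAff_subst {e q : ArithExpr} {s : ℕ} {gs extra : List ArithExpr} {δ : ℚ} {B : Box}
    {t : KdCert LeafMul} (hδ : 0 < δ)
    (h : t.check (leafCheckAff (substVar s q e) (gs.map (substVar s q) ++ extra) (-δ)) B = true)
    (x : ℕ → ℝ) (hx : B.mem x) (hs : x s = q.eval x)
    (hg : ∀ g ∈ gs, 0 ≤ g.eval x) (hextra : ∀ g ∈ extra, 0 ≤ g.eval x) : e.eval x < 0 := by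
  have h1 := eval_lt_zero_of_kdCheckAff hδ h x hx (fun g hg' => by
    rw [List.mem_append, List.mem_map] at hg'
    rcases hg' with ⟨g₀, hg₀, rfl⟩ | hge
    · rw [eval_substVar_of_eq hs]; exact hg g₀ hg₀
    · exact hextra g hge)
  rwa [eval_substVar_of_eq hs] at h1

/-- The `0 ≤ e` form with an eliminated coordinate (damping-sign hypotheses). [cite: FigueiredoStolfi2004, §3] -/
theorem eval_nonneg_of_kdCheckAff_subst {e q : ArithExpr} {s : ℕ} {gs extra : List ArithExpr} {B : Box}
    {t : KdCert LeafMul}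
    (h : t.check (leafCheckAff (.neg (substVar s q e)) (gs.map (substVar s q) ++ extra) 0) B = true)
    (x : ℕ → ℝ) (hx : B.mem x) (hs : x s = q.eval x)
    (hg : ∀ g ∈ gs, 0 ≤ g.eval x) (hextra : ∀ g ∈ extra, 0 ≤ g.eval x) : 0 ≤ e.eval x := by
  have h1 := eval_nonneg_of_kdCheckAff h x hx (fun g hg' => by
    rw [List.mem_append, List.mem_map] at hg'
    rcases hg' with ⟨g₀, hg₀, rfl⟩ | hge
    · rw [eval_substVar_of_eq hs]; exact hg g₀ hg₀
    · exact hextra g hge)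
  rwa [eval_substVar_of_eq hs] at h1

/-- Kernel example (mechanics only; no rung is claimed): on `x₀ ∈ [0, 1]`, `x₀(1 − x₀) − 3/8 < 0`, certified on the four
quarter cells at scale `2^10` (affine forms `c + a ε ± r` with `r` = the quadratic remainder; e.g. on `[1/4, 1/2]` the form of
`x₀(1−x₀)` is `15/64 + (2/64)ε ± 1/64`); two leaves carry the (useless here, but exercised) slack `x₀ ≥ 0` with multiplier `0`. -/
example : ∀ x : ℕ → ℝ, Box.mem [(0, 1)] x → 0 ≤ (ArithExpr.var 0).eval x →
    (ArithExpr.sub (.mul (.var 0) (.sub (.const 1) (.var 0))) (.const (3 / 8))).eval x < 0 := by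
  intro x hx hg
  have hcheck : (KdCert.split 0 (1 / 2) (.split 0 (1 / 4) (.leaf ⟨10, []⟩) (.leaf ⟨10, [0]⟩))
      (.split 0 (3 / 4) (.leaf ⟨10, []⟩) (.leaf ⟨10, [0]⟩))).check
      (leafCheckAff (.sub (.mul (.var 0) (.sub (.const 1) (.var 0))) (.const (3 / 8))) [.var 0] (-(1 / 64))) [(0, 1)] = true := by
    decide +kernel
  exact eval_lt_zero_of_kdCheckAff (by norm_num) hcheck x hx (fun g hg' => by
    simp only [List.mem_singleton] at hg'
    subst hg'
    exact hg)

end Summit.NavierStokesRegularity.NavierStokesRegularity.Theorems.VirtualFloor.KernelFaceAffine
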